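import Mathlib
import Summits.Ventures.PercRepro2.SwOutMixedBaseArm
import Summits.Ventures.PercRepro2.SwOutMixedArmsBaseDual

/-!
# The several-arms base: `G5` is the arm principle for the coarse arm of `u` (blind cell
PercRepro2, night-4 g20, 2026-08-27; proofs/NIGHT4-G20.md §4′)

At a point with every u-arm red and EVERY arm dropped (all u–p_r edges blue), the coarse arm of
`u` in the hull is `X = {u} ∪ ⋃ U j` (`coarseXR`): it is a union of arms of the hull
(`armClosed_coarseXR`), lies in the red cluster, and the point is core-free (`coreFree_top`).
Flipping `X` is the move to the point with every u-arm blue and every u–p_r edge red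
(`flip_coarseXR`), so the landed arm principle `flip_mem_tgtU_of_armClosed_red` gives **G5**: the
conditioning is preserved by that move (`mem_tgtU_toggleXR`) — the hypothesis `hG` of the interface
`card_le_of_mixedArms_edges`, in the form the several-arms lemma assumes it (at all-dropped points
only).  The single-arm twin is `SwOutMixedBaseArm`.
-/

namespace Summit.Ventures.PercRepro2

namespace MixedArms

open Hull LocRows BigBlock

variable {V : Type*} {E : Type*}

open scoped Classical

section ArmDefs

variable {ι ρ ν κ : Type*}

/-- The X-move of a point: every u-arm toggled, every u–p edge toggled. -/
def toggleXR (q : PtR ι ρ ν κ) : PtR ι ρ ν κ :=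
  (flipAll q.1, q.2.1, fun r => !q.2.2.1 r, q.2.2.2.1, q.2.2.2.2)

end ArmDefs

section Arm

variable {ends : E → Sym2 V} {σ : Config E} {h u : V} {ι ρ ν κ : Type*} {U : ι → Set V}
  {p : ρ → V} {Ah : ν → Set V} {arm : ν → ρ} {F : κ → Set V}
  (hb : MixedBaseR ends σ h u U p Ah arm F)
include hb

/-- An edge touches `coarseX` iff it touches a u-arm or is a u–p edge. -/
lemma MixedBaseR.touches_coarseX_iff {e : E} :
    e ∈ touches ends (coarseX u U) ↔ (∃ j, e ∈ touches ends (U j)) ∨ ∃ r, e ∈ clsUPR ends u p r := by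
  constructor
  · rintro ⟨x, hx, y, hxy⟩
    rcases hx with hx | hx
    · rw [Set.mem_singleton_iff] at hx
      subst hx
      rcases hb.u_edges e y hxy with ⟨j, hj⟩ | ⟨r, rfl⟩
      · exact Or.inl ⟨j, y, hj, x, ends_swap hxy⟩
      · exact Or.inr ⟨r, hxy⟩
    · obtain ⟨j, hj⟩ := Set.mem_iUnion.1 hx
      exact Or.inl ⟨j, x, hj, y, hxy⟩
  · rintro (⟨j, x, hx, y, hxy⟩ | ⟨r, hup⟩)
    · exact ⟨x, Or.inr (Set.mem_iUnion.2 ⟨j, hx⟩), y, hxy⟩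
    · exact ⟨u, Or.inl rfl, p r, hup⟩

/-- **Flipping the coarse arm of `u` is the X-move.** -/
theorem MixedBaseR.flip_coarseX (q : PtR ι ρ ν κ) :
    flip ends (coarseX u U) (mixedRealR ends u U p Ah F σ q) =
      mixedRealR ends u U p Ah F σ (toggleXR q) := by
  funext e
  by_cases hX : e ∈ touches ends (coarseX u U)
  · rw [flip_apply_of_mem hX]
    rcases hb.touches_coarseX_iff.1 hX with ⟨j, hj⟩ | ⟨r, hup⟩
    · rw [hb.mixedRealR_apply_U hj, hb.mixedRealR_apply_U hj]
      simp only [toggleXR, flipAll]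
      by_cases hj' : q.1 j = true <;> simp [hj']
    · rw [hb.mixedRealR_apply_UP hup, hb.mixedRealR_apply_UP hup]
      simp only [toggleXR]
      by_cases hc' : q.2.2.1 r = true <;> simp [hc']
  · rw [flip_apply_of_notMem hX]
    have hU : ∀ j, e ∉ touches ends (U j) := fun j hj =>
      hX (hb.touches_coarseX_iff.2 (Or.inl ⟨j, hj⟩))
    have hUP : ∀ r, e ∉ clsUPR ends u p r := fun r hup =>
      hX (hb.touches_coarseX_iff.2 (Or.inr ⟨r, hup⟩))
    by_cases hA : ∃ i, e ∈ touches ends (Ah i)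
    · obtain ⟨i, hi⟩ := hA
      rw [hb.mixedRealR_apply_Ah hi, hb.mixedRealR_apply_Ah hi]
      rfl
    by_cases hXt : ∃ r, e ∈ clsExtR ends u p Ah r
    · obtain ⟨r, hr⟩ := hXt
      rw [hb.mixedRealR_apply_Ext hr, hb.mixedRealR_apply_Ext hr]
      rfl
    by_cases hF : ∃ k, e ∈ touches ends (F k)
    · obtain ⟨k, hk⟩ := hF
      rw [hb.mixedRealR_apply_F hk, hb.mixedRealR_apply_F hk]
      rfl
    · simp only [not_exists] at hA hXt hF
      rw [MixedBaseR.mixedRealR_apply_none hU hA hUP hXt hF,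
        MixedBaseR.mixedRealR_apply_none hU hA hUP hXt hF]

omit hb in
/-- At an all-dropped point there is no red-side leak. -/
lemma not_leakRR_of_top {q : PtR ι ρ ν κ} (huP : ∀ r, q.2.2.1 r = false) : ¬ LeakRR arm q := by
  rintro ⟨_, r, h2, _⟩
  rw [huP r] at h2
  exact absurd h2 (by decide)

omit hb in
/-- At a point with every u-arm red there is no blue-side leak. -/
lemma not_leakBR_of_top {q : PtR ι ρ ν κ} (hs : ∀ j, q.1 j = true) : ¬ LeakBR arm q := by
  rintro ⟨⟨j, hj⟩, _, _⟩
  simp only [flipPt, flipAll] at hj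
  rw [hs j] at hj
  exact absurd hj (by decide)

/-- The red cluster at a point with every u-arm red and every arm dropped. -/
lemma MixedBaseR.cluster_top [Nonempty ι] (hup : ∀ r, ∃ e, ends e = s(u, p r))
    {q : PtR ι ρ ν κ} (hs : ∀ j, q.1 j = true) (huP : ∀ r, q.2.2.1 r = false) {x : V} :
    x ∈ cluster ends (mixedRealR ends u U p Ah F σ q) h ↔
      x = h ∨ (∃ j, x ∈ U j) ∨ x = u ∨ (∃ i, q.2.1 i = true ∧ x ∈ Ah i) ∨
        ∃ k, q.2.2.2.2 k = true ∧ x ∈ F k := by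
  rw [hb.cluster_mixedRealR hup (not_leakRR_of_top huP), mem_redSetR_iff]
  obtain ⟨j₀⟩ := (inferInstance : Nonempty ι)
  constructor
  · rintro (hxh | ⟨j, _, hx⟩ | ⟨hxu, _⟩ | ⟨r, _, _, hP⟩ | ⟨i, hi, hx⟩ | ⟨k, hk, hx⟩)
    · exact Or.inl hxh
    · exact Or.inr (Or.inl ⟨j, hx⟩)
    · exact Or.inr (Or.inr (Or.inl hxu))
    · rw [huP r] at hP
      exact absurd hP (by decide)
    · exact Or.inr (Or.inr (Or.inr (Or.inl ⟨i, hi, hx⟩)))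
    · exact Or.inr (Or.inr (Or.inr (Or.inr ⟨k, hk, hx⟩)))
  · rintro (hxh | ⟨j, hx⟩ | hxu | ⟨i, hi, hx⟩ | ⟨k, hk, hx⟩)
    · exact Or.inl hxh
    · exact Or.inr (Or.inl ⟨j, hs j, hx⟩)
    · exact Or.inr (Or.inr (Or.inl ⟨hxu, j₀, hs j₀⟩))
    · exact Or.inr (Or.inr (Or.inr (Or.inr (Or.inl ⟨i, hi, hx⟩))))
    · exact Or.inr (Or.inr (Or.inr (Or.inr (Or.inr ⟨k, hk, hx⟩))))

/-- The blue cluster at a point with every u-arm red. -/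
lemma MixedBaseR.cluster_blue_top (hup : ∀ r, ∃ e, ends e = s(u, p r)) {q : PtR ι ρ ν κ}
    (hs : ∀ j, q.1 j = true) {x : V} :
    x ∈ cluster ends (blue (mixedRealR ends u U p Ah F σ q)) h ↔
      x = h ∨ (∃ i, q.2.1 i = false ∧ x ∈ Ah i) ∨ ∃ k, q.2.2.2.2 k = false ∧ x ∈ F k := by
  rw [hb.cluster_blue_mixedRealR hup (not_leakBR_of_top hs), mem_redSetR_iff]
  have hs' : ∀ j, (flipPt q).1 j = false := by
    intro j
    simp only [flipPt, flipAll]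
    rw [hs j]
    rfl
  constructor
  · rintro (hxh | ⟨j, hj, _⟩ | ⟨_, j, hj⟩ | ⟨_, _, ⟨j, hj⟩, _⟩ | ⟨i, hi, hx⟩ | ⟨k, hk, hx⟩)
    · exact Or.inl hxh
    · rw [hs' j] at hj
      exact absurd hj (by decide)
    · rw [hs' j] at hj
      exact absurd hj (by decide)
    · rw [hs' j] at hj
      exact absurd hj (by decide)
    · refine Or.inr (Or.inl ⟨i, ?_, hx⟩)
      simp only [flipPt, flipAll] at hi
      cases h' : q.2.1 i
      · rfl
      · rw [h'] at hi
        exact absurd hi (by decide)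
    · refine Or.inr (Or.inr ⟨k, ?_, hx⟩)
      simp only [flipPt, flipAll] at hk
      cases h' : q.2.2.2.2 k
      · rfl
      · rw [h'] at hk
        exact absurd hk (by decide)
  · rintro (hxh | ⟨i, hi, hx⟩ | ⟨k, hk, hx⟩)
    · exact Or.inl hxh
    · refine Or.inr (Or.inr (Or.inr (Or.inr (Or.inl ⟨i, ?_, hx⟩))))
      simp only [flipPt, flipAll]
      rw [hi]
      rfl
    · refine Or.inr (Or.inr (Or.inr (Or.inr (Or.inr ⟨k, ?_, hx⟩))))
      simp only [flipPt, flipAll]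
      rw [hk]
      rfl

/-- **An all-dropped point with every u-arm red is core-free.** -/
theorem MixedBaseR.coreFree_top [Nonempty ι] (hup : ∀ r, ∃ e, ends e = s(u, p r))
    {q : PtR ι ρ ν κ} (hs : ∀ j, q.1 j = true) (huP : ∀ r, q.2.2.1 r = false) :
    CoreFree ends (mixedRealR ends u U p Ah F σ q) h := by
  intro x hxT hxB
  rw [hb.cluster_top hup hs huP] at hxT
  rw [hb.cluster_blue_top hup hs] at hxB
  rcases hxB with hxh | ⟨i, hi', hxA⟩ | ⟨k, hk', hxF⟩
  · exact hxh
  · rcases hxT with hxh | ⟨j, hxU⟩ | hxu | ⟨i', hi, hxA'⟩ | ⟨k, _, hxF⟩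
    · exact hxh
    · exact absurd hxA (hb.U_disj_Ah j i x hxU)
    · rw [hxu] at hxA
      exact absurd hxA (hb.u_notMem_Ah i)
    · by_cases hii : i = i'
      · subst hii
        rw [hi] at hi'
        exact absurd hi' (by decide)
      · exact absurd hxA' (hb.Ah_disj i i' hii x hxA)
    · exact absurd hxF (hb.Ah_disj_F i k x hxA)
  · rcases hxT with hxh | ⟨j, hxU⟩ | hxu | ⟨i, _, hxA⟩ | ⟨k', hk, hxF'⟩
    · exact hxh
    · exact absurd hxF (hb.U_disj_F j k x hxU)
    · rw [hxu] at hxF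
      exact absurd hxF (hb.u_notMem_F k)
    · exact absurd hxF (hb.Ah_disj_F i k x hxA)
    · by_cases hkk : k = k'
      · subst hkk
        rw [hk] at hk'
        exact absurd hk' (by decide)
      · exact absurd hxF' (hb.F_disj k k' hkk x hxF)

/-- The coarse arm of `u` lies in the red cluster at such a point. -/
lemma MixedBaseR.coarseX_subset_cluster [Nonempty ι] (hup : ∀ r, ∃ e, ends e = s(u, p r))
    {q : PtR ι ρ ν κ} (hs : ∀ j, q.1 j = true) (huP : ∀ r, q.2.2.1 r = false) :
    coarseX u U ⊆ cluster ends (mixedRealR ends u U p Ah F σ q) h := by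
  intro x hx
  rw [hb.cluster_top hup hs huP]
  rcases hx with hx | hx
  · exact Or.inr (Or.inr (Or.inl hx))
  · obtain ⟨j, hj⟩ := Set.mem_iUnion.1 hx
    exact Or.inr (Or.inl ⟨j, hj⟩)

/-- **The coarse arm of `u` is a union of arms of the hull** at such a point. -/
theorem MixedBaseR.armClosed_coarseX [Nonempty ι] (hup : ∀ r, ∃ e, ends e = s(u, p r))
    {q : PtR ι ρ ν κ} (hs : ∀ j, q.1 j = true) (huP : ∀ r, q.2.2.1 r = false) :
    ArmClosed ends (mixedRealR ends u U p Ah F σ q) h (coarseX u U) where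
  subset := by
    intro x hx
    refine ⟨Or.inl (hb.coarseX_subset_cluster hup hs huP hx), ?_⟩
    rcases hx with hx | hx
    · rw [Set.mem_singleton_iff] at hx
      rw [hx]
      exact hb.hne_hu.symm
    · obtain ⟨j, hj⟩ := Set.mem_iUnion.1 hx
      rintro rfl
      exact hb.h_notMem_U j hj
  closed := by
    intro e x y hxy hx hy hyh
    rcases hx with hx | hx
    · -- x = u: the edge goes into a u-arm or to a dropped vertex; dropped vertices are not in the hull
      rw [Set.mem_singleton_iff] at hx
      rw [hx] at hxy
      rcases hb.u_edges e y hxy with ⟨j, hj⟩ | ⟨r, rfl⟩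
      · exact Or.inr (Set.mem_iUnion.2 ⟨j, hj⟩)
      · exfalso
        rcases hy with hy | hy
        · rw [hb.cluster_top hup hs huP] at hy
          rcases hy with hyh' | ⟨j, hj⟩ | hyu | ⟨i, _, hA⟩ | ⟨k, _, hF⟩
          · exact hb.hne_hp r hyh'.symm
          · exact hb.p_notMem_U r j hj
          · exact hb.hne_up r hyu.symm
          · exact hb.p_notMem_Ah r i hA
          · exact hb.p_notMem_F r k hF
        · rw [hb.cluster_blue_top hup hs] at hy
          rcases hy with hyh' | ⟨i, _, hA⟩ | ⟨k, _, hF⟩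
          · exact hb.hne_hp r hyh'.symm
          · exact hb.p_notMem_Ah r i hA
          · exact hb.p_notMem_F r k hF
    · -- x in a u-arm: the edge stays inside, goes to h (excluded), to u, or outside the hull
      obtain ⟨j, hj⟩ := Set.mem_iUnion.1 hx
      obtain ⟨x', y', hxy', hx', hy'⟩ := hb.ends_of_touches_U ⟨x, hj, y, hxy⟩
      rw [hxy, Sym2.eq_iff] at hxy'
      rcases hxy' with ⟨h1, h2⟩ | ⟨h1, h2⟩
      · rw [← h2] at hy'
        rcases hy' with hy' | hy' | hy' | ⟨hyh', hyu, hyp, hout⟩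
        · exact Or.inr (Set.mem_iUnion.2 ⟨j, hy'⟩)
        · exact absurd hy' hyh
        · exact Or.inl hy'
        · exfalso
          rcases hy with hy | hy
          · rw [hb.cluster_top hup hs huP] at hy
            rcases hy with hyh'' | ⟨j', hj'⟩ | hyu' | ⟨i, _, hA⟩ | ⟨k, _, hF⟩
            · exact hyh hyh''
            · exact hout (Or.inl (Or.inl (Set.mem_iUnion.2 ⟨j', hj'⟩)))
            · exact hyu hyu'
            · exact hout (Or.inl (Or.inr (Set.mem_iUnion.2 ⟨i, hA⟩)))
            · exact hout (Or.inr (Set.mem_iUnion.2 ⟨k, hF⟩))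
          · rw [hb.cluster_blue_top hup hs] at hy
            rcases hy with hyh'' | ⟨i, _, hA⟩ | ⟨k, _, hF⟩
            · exact hyh hyh''
            · exact hout (Or.inl (Or.inr (Set.mem_iUnion.2 ⟨i, hA⟩)))
            · exact hout (Or.inr (Set.mem_iUnion.2 ⟨k, hF⟩))
      · rw [← h2] at hx'
        exact Or.inr (Set.mem_iUnion.2 ⟨j, hx'⟩)

/-- **G5 is the arm principle**: at a point with every u-arm red and every arm dropped, the X-move
keeps the conditioning. -/
theorem MixedBaseR.mem_tgtU_toggleXR [Fintype E] [DecidableEq E] [Nonempty ι]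
    (hup : ∀ r, ∃ e, ends e = s(u, p r)) {Us : Set V} {l o : V} (hXU : coarseX u U ⊆ Us)
    (hl : l ∉ Us) {q : PtR ι ρ ν κ} (hs : ∀ j, q.1 j = true) (huP : ∀ r, q.2.2.1 r = false)
    (hQ : mixedRealR ends u U p Ah F σ q ∈ tgtU ends l h {S : Set V | o ∈ S}) :
    mixedRealR ends u U p Ah F σ (toggleXR q) ∈ tgtU ends l h {S : Set V | o ∈ S} := by
  rw [← hb.flip_coarseX]
  exact flip_mem_tgtU_of_armClosed_red (hb.coreFree_top hup hs huP)
    (hb.armClosed_coarseX hup hs huP) (hb.coarseX_subset_cluster hup hs huP) hXU hl hQ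

end Arm

end MixedArms

end Summit.Ventures.PercRepro2
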